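import Summits.QuantumFields.BalabanUV.Beta.MultiscaleRegularityClosed

/-!
# `Summit.QuantumFields.BalabanUV.Beta.MultiscaleGradientSource` — engine file 19a: the pieces of the GRADIENT member's assembly —
# FLAT bookkeeping (`(Df)(b,i) = c_b(f(b₊,i) − f(b₋,i))`, the component identity `(D*Df)(y,i) = W·f_i(y) − (N f_i)(y)` for `Rm ≡ 1`),
# and, on the `d_n`-ball of radius 1 around a site, the CLOSED sup member and the AVERAGING PART of `levelOp` read in SUP currency
# in the currency of the centre (`n(y) ≤ Γn(x)`; `|Σ_l a_lG_lᵀG_l f| ≤ a_max√|Cp|·𝔅·e^{δ(4d+1)}·e^{−δd_n(x,t)}·m` via the (P) budget)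

HONEST FRAMING (page 1 of everything in this cell).  Discharging `FlowStep.BetaPertH` would make Bałaban's ultraviolet
stability UNCONDITIONAL — a constructive-QFT result; it is NOT the continuum limit and NOT the Clay problem.  This module
discharges nothing of `BetaPertH`; it is [folklore] finite-dimensional bookkeeping about the MODEL operator, kernel-checked, by the
OWNER of binder row D4 (unit `b2b-balaban-beta-an4`, gen 46).  HONEST DEPENDENCY: continuum YM on T⁴ ⇐ BetaPertH ∧ nine spine
estimates (0/9 proved); BetaPertH ⇐ (D1) ∧ (D4) ∧ CAP+tail; G-an2-4 gates asym, D1 and NE2/3/4.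

THE POINT (O.2 item (i), MODEL level; NOT the critical path).  File 19b `MultiscaleGradientMember` derives the gradient member
(3.42)₂'s SHAPE for `levelOp = D*D + Σ_l a_l G_lᵀG_l` with FLAT transport from ONE binder, the flat Poisson interior gradient
estimate (FG) (co-owner beta-d4-p2's `GradientMemberBox` shape), by a DIRECT assembly from file 17's CLOSED sup member.  This file
holds the three ingredients that do not mention the binder: §1 for FLAT transport `Rm_b(k,i) = δ_{ki}` (any bond weights) the
covariant derivative is the plain weighted difference componentwise (`covD_flat`) and each component of the covariant Laplacian is
the scalar weighted Laplacian of that component in the `W·w − Nw` currency of files 12∕14∕GR1 (`covLap_flat_component`) — so each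
component of `f = (levelOp)⁻¹u` solves `W·f_i − N f_i = u_i − (Σ_l a_lG_lᵀG_l f)_i`; §2 under the sitewise additive grading
(`|e(x) − e(y)| ≤ A + d_n(x,y)/R`, sides `L^e`) every `y` with `d_n(y,x) ≤ 1` has `n(y) ≤ Γ·n(x)`, `Γ = L^A e^{(log L/R)(4d+1)}`
(`scale_le_on_unit_ball`, from beta-d4-p2's `scale_le_scale_mul_exp_add`), hence a sup bound of the sup member's shape
`|f(q)| ≤ 𝔅·n(q)²·e^{−δd_n(q,t)}·m` reads `|f(y,j)| ≤ 𝔅Γ²e^{δ}·n(x)²·e^{−δd_n(x,t)}·m` on that ball (`abs_le_on_unit_ball`); §3 the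
averaging part there is `≤ a_max·√|Cp|·𝔅·e^{δ(4d+1)}·e^{−δd_n(x,t)}·m` (`abs_levelSum_le_on_unit_ball`: 10a's (P) budget
`a_max·n(y)⁻²·√(n(y)^{−d}Σ_{cell(y)} f²)` — `abs_levelSum_apply_le` — with `card_cellCp_le` and 16b's `cell_in_ball`; the two powers
of `n(y)` cancel exactly, no scale comparison needed).  WHAT THIS IS NOT: nothing of Bałaban's G′(U) or ∇_U is instantiated; the
(3.16)∕(3.42) tags are LOCATORS; row D4 readiness width 0; D4 DISCHARGE NO DATE.

WHAT IS CERTIFIED (kernel, 0 sorry, 0 def): §1 `covD_flat`, `covLap_flat_component`; §2 `scale_le_on_unit_ball`, `abs_le_on_unit_ball`;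
§3 `abs_levelSum_le_on_unit_ball`.  LOCATORS (shape only; ABSOLUTE RULE — nothing printed is asserted): [Balaban1985BackgroundPropagators]
(3.3) pp. 390–391, (3.8) p. 392, (3.16) p. 393, Thm 3.1 (3.42) p. 397.  NOT BetaPertH, NOT continuum, NOT Clay, NOT summit progress.
-/

open scoped BigOperators
open Finset

namespace Summit.QuantumFields.BalabanUV.Beta.MultiscaleGradientSource

open Summit.QuantumFields.BalabanUV.Beta.BoxPoincare (Box)
open Summit.QuantumFields.BalabanUV.Beta.MultiscaleCoerciveTorus
open Summit.QuantumFields.BalabanUV.Beta.MultiscaleDistance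
open Summit.QuantumFields.BalabanUV.Beta.MultiscaleDistanceMetric (sdist_comm sdist_triangle_torus)
open Summit.QuantumFields.BalabanUV.Beta.MultiscaleDistanceGraded (scale_le_scale_mul_exp_add)
open Summit.QuantumFields.BalabanUV.Beta.MultiscaleDecayBudget
open Summit.QuantumFields.BalabanUV.Beta.MultiscaleSupMemberBall (card_cellCp_le)
open Summit.QuantumFields.BalabanUV.Beta.MultiscaleAveragingPointwise (abs_levelSum_apply_le)
open Summit.QuantumFields.BalabanUV.Beta.MultiscaleRegularitySource (cell_in_ball)
open Literature.MathematicalPhysics.QuantumFieldTheory.Balaban1983to89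
open Literature.MathematicalPhysics.QuantumFieldTheory.Balaban1983to89.B9Thm37Glue (covD covDT covD_apply covDT_apply)
open Literature.MathematicalPhysics.QuantumFieldTheory.Balaban1983to89.B9Thm37GluePU (bsrc btgt bsrc_apply btgt_apply)
open Literature.MathematicalPhysics.QuantumFieldTheory.Balaban1983to89.B9Thm37GlueTorusCov (tblk)
open Literature.MathematicalPhysics.QuantumFieldTheory.Balaban1983to89.B9Thm37GlueTorusCovLevels (levelSum)
open B5TorusCover (UT Ctr ctrU)
open B5Leibniz121 (up dn)

noncomputable section

variable {d : ℕ} {N : Fin d → ℕ} [∀ i, NeZero (N i)]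

/-! ## §1 Flat bookkeeping: the covariant derivative and the covariant Laplacian, componentwise, for `Rm ≡ 1` -/

/-- For FLAT transport `Rm ≡ 1` the covariant derivative is the plain weighted difference, componentwise:
`(Df)(b,i) = c_b·(f(b₊,i) − f(b₋,i))`. [folklore] -/
theorem covD_flat {Cp : Type} [Fintype Cp] [DecidableEq Cp] {Rm : UT N × Fin d → Cp → Cp → ℝ}
    (hflat : ∀ b k i, Rm b k i = if k = i then 1 else 0) (c : UT N × Fin d → ℝ) (f : UT N × Cp → ℝ) (b : UT N × Fin d) (i : Cp) :
    covD bsrc btgt c Rm f (b, i) = c b * (f (btgt b, i) - f (bsrc b, i)) := by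
  rw [covD_apply]
  have h : ∑ j, Rm b i j * f (btgt b, j) = f (btgt b, i) := by
    simp_rw [hflat]
    simp only [ite_mul, one_mul, zero_mul, Finset.sum_ite_eq, Finset.mem_univ, if_true]
  rw [h]

/-- **THE FLAT COMPONENT IDENTITY.**  For FLAT transport `Rm ≡ 1` (any bond weights) each component of the covariant Laplacian is
the scalar weighted Laplacian of that component, in the `W·w − Nw` currency of files 12∕14∕GR1:
`(D*Df)(y,i) = (Σ_{b₊ = y} c_b² + Σ_{b₋ = y} c_b²)·f(y,i) − (Σ_{b₊ = y} c_b²·f(b₋,i) + Σ_{b₋ = y} c_b²·f(b₊,i))`. [folklore] -/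
theorem covLap_flat_component {Cp : Type} [Fintype Cp] [DecidableEq Cp] {Rm : UT N × Fin d → Cp → Cp → ℝ}
    (hflat : ∀ b k i, Rm b k i = if k = i then 1 else 0) (c : UT N × Fin d → ℝ) (f : UT N × Cp → ℝ) (y : UT N) (i : Cp) :
    covDT bsrc btgt c Rm (covD bsrc btgt c Rm f) (y, i) =
      ((∑ b ∈ univ.filter (fun b : UT N × Fin d => btgt b = y), c b ^ 2) +
          ∑ b ∈ univ.filter (fun b : UT N × Fin d => bsrc b = y), c b ^ 2) * f (y, i) -
        ((∑ b ∈ univ.filter (fun b : UT N × Fin d => btgt b = y), c b ^ 2 * f (bsrc b, i)) +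
          ∑ b ∈ univ.filter (fun b : UT N × Fin d => bsrc b = y), c b ^ 2 * f (btgt b, i)) := by
  rw [covDT_apply]
  have hin : ∀ b : UT N × Fin d, ∀ k : Cp, covD bsrc btgt c Rm f (b, k) = c b * (f (btgt b, k) - f (bsrc b, k)) :=
    fun b k => covD_flat hflat c f b k
  have h1 : ∀ b : UT N × Fin d, ∑ k, Rm b k i * covD bsrc btgt c Rm f (b, k) = c b * (f (btgt b, i) - f (bsrc b, i)) := by
    intro b
    simp_rw [hflat, hin]
    simp only [ite_mul, one_mul, zero_mul, Finset.sum_ite_eq', Finset.mem_univ, if_true]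
  simp_rw [h1]
  simp only [show ∀ b : UT N × Fin d, covD bsrc btgt c Rm f (b, i) = c b * (f (btgt b, i) - f (bsrc b, i)) from fun b => hin b i]
  rw [Finset.sum_sub_distrib]
  have hT : ∑ b : UT N × Fin d, (if btgt b = y then c b else 0) * (c b * (f (btgt b, i) - f (bsrc b, i))) =
      ∑ b ∈ univ.filter (fun b : UT N × Fin d => btgt b = y), (c b ^ 2 * f (y, i) - c b ^ 2 * f (bsrc b, i)) := by
    rw [Finset.sum_filter]
    refine Finset.sum_congr rfl fun b _ => ?_
    split_ifs with h
    · rw [h]; ring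
    · ring
  have hS : ∑ b : UT N × Fin d, (if bsrc b = y then c b else 0) * (c b * (f (btgt b, i) - f (bsrc b, i))) =
      ∑ b ∈ univ.filter (fun b : UT N × Fin d => bsrc b = y), (c b ^ 2 * f (btgt b, i) - c b ^ 2 * f (y, i)) := by
    rw [Finset.sum_filter]
    refine Finset.sum_congr rfl fun b _ => ?_
    split_ifs with h
    · rw [h]; ring
    · ring
  rw [hT, hS, Finset.sum_sub_distrib, Finset.sum_sub_distrib, ← Finset.sum_mul, ← Finset.sum_mul]
  ring

/-! ## §2 On the `d_n`-ball of radius 1: scale comparison and the sup member in the currency of the centre -/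

section Ball

variable [NeZero d] {J K : Type} [Fintype J] [Fintype K] [DecidableEq K] (S : J → ℕ) (hS : ∀ l, 1 ≤ S l)
  (hdivS : ∀ l i, S l ∣ N i) (lvl : K → J) (zc : (k : K) → Ctr N (S (lvl k)))
  (hcover : ∀ x : UT N, ∃ k, ∃ v : Box d (S (lvl k)), cellPt S hS hdivS lvl zc k v = x)
  {L : ℕ} (hL : 1 ≤ L) (e : J → ℕ) (hSe : ∀ l, S l = L ^ e l) {R : ℝ} (hR : 0 < R) {A : ℕ}
  (hadd : ∀ x y : UT N, |(e (lvl (cellOf S hS hdivS lvl zc hcover x)) : ℝ) - e (lvl (cellOf S hS hdivS lvl zc hcover y))| ≤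
    A + sdist bsrc btgt (siteScale S hS hdivS lvl zc hcover) x y / R)

include hL e hSe hR hadd

omit [NeZero d] [Fintype J] [Fintype K] [DecidableEq K] in
/-- **Scale comparison on the `d_n`-ball of radius 1**: under the additive grading, `d_n(y,x) ≤ 1` ⟹ `n(y) ≤ Γ·n(x)` with
`Γ = L^A·e^{(log L/R)(4d+1)}` (even `L^A e^{log L/R}` would do). [folklore] -/
theorem scale_le_on_unit_ball {Γ : ℝ} (hΓ : Γ = (L : ℝ) ^ A * Real.exp (Real.log L / R * (4 * d + 1))) {x y : UT N}
    (hy : sdist bsrc btgt (siteScale S hS hdivS lvl zc hcover) y x ≤ 1) :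
    (siteScale S hS hdivS lvl zc hcover y : ℝ) ≤ Γ * siteScale S hS hdivS lvl zc hcover x := by
  set n := siteScale S hS hdivS lvl zc hcover with hn
  have hL1 : (1 : ℝ) ≤ L := by exact_mod_cast hL
  have ht0 : 0 ≤ Real.log L / R := div_nonneg (Real.log_nonneg hL1) hR.le
  have hgr : ∀ y, n y = L ^ (e (lvl (cellOf S hS hdivS lvl zc hcover y))) := fun y => by rw [hn, siteScale, hSe]
  have h := scale_le_scale_mul_exp_add bsrc btgt n hL (fun y => e (lvl (cellOf S hS hdivS lvl zc hcover y))) hgr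
    (A := A) (hadd x y)
  have hsym : sdist bsrc btgt n x y = sdist bsrc btgt n y x := sdist_comm bsrc btgt n x y
  have hd0 : (0 : ℝ) ≤ 4 * d := by positivity
  have hexp : Real.exp (Real.log L / R * sdist bsrc btgt n x y) ≤ Real.exp (Real.log L / R * (4 * d + 1)) :=
    Real.exp_le_exp.mpr (mul_le_mul_of_nonneg_left (by rw [hsym]; linarith) ht0)
  have hnx : (0 : ℝ) ≤ n x := Nat.cast_nonneg _
  calc (n y : ℝ) ≤ (L : ℝ) ^ A * n x * Real.exp (Real.log L / R * sdist bsrc btgt n x y) := h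
    _ ≤ (L : ℝ) ^ A * n x * Real.exp (Real.log L / R * (4 * d + 1)) := by gcongr
    _ = Γ * n x := by rw [hΓ]; ring

omit [NeZero d] [Fintype J] [Fintype K] [DecidableEq K] in
/-- **(α) A sup bound of the shape `|f(q)| ≤ 𝔅·n(q)²·e^{−δd_n(q,t)}·m` read on the `d_n`-ball of radius 1 around `x` in the
currency of the centre**: `|f(y,j)| ≤ 𝔅Γ²e^{δ}·n(x)²·e^{−δd_n(x,t)}·m` for `d_n(y,x) ≤ 1` (scale comparison + triangle inequality). [folklore] -/
theorem abs_le_on_unit_ball {Cp : Type} {Γ : ℝ} (hΓ : Γ = (L : ℝ) ^ A * Real.exp (Real.log L / R * (4 * d + 1)))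
    {δ 𝔅 m : ℝ} (hδ0 : 0 ≤ δ) (h𝔅0 : 0 ≤ 𝔅) (hm : 0 ≤ m) (f : UT N × Cp → ℝ) (t : UT N)
    (hsup : ∀ q : UT N × Cp, |f q| ≤ 𝔅 * (siteScale S hS hdivS lvl zc hcover q.1 : ℝ) ^ 2 *
      Real.exp (-(δ * sdist bsrc btgt (siteScale S hS hdivS lvl zc hcover) q.1 t)) * m)
    {x y : UT N} (hy : sdist bsrc btgt (siteScale S hS hdivS lvl zc hcover) y x ≤ 1) (j : Cp) :
    |f (y, j)| ≤ 𝔅 * Γ ^ 2 * Real.exp δ * (siteScale S hS hdivS lvl zc hcover x : ℝ) ^ 2 *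
      Real.exp (-(δ * sdist bsrc btgt (siteScale S hS hdivS lvl zc hcover) x t)) * m := by
  set n := siteScale S hS hdivS lvl zc hcover with hn
  have h1 := hsup (y, j)
  dsimp only at h1
  have hny0 : (0 : ℝ) ≤ n y := Nat.cast_nonneg _
  have hny : (n y : ℝ) ^ 2 ≤ (Γ * n x) ^ 2 :=
    pow_le_pow_left₀ hny0 (scale_le_on_unit_ball S hS hdivS lvl zc hcover hL e hSe hR hadd hΓ hy) 2
  have htri : sdist bsrc btgt n x t ≤ sdist bsrc btgt n x y + sdist bsrc btgt n y t := sdist_triangle_torus n x y t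
  have hsym : sdist bsrc btgt n x y = sdist bsrc btgt n y x := sdist_comm bsrc btgt n x y
  have hexp : Real.exp (-(δ * sdist bsrc btgt n y t)) ≤ Real.exp δ * Real.exp (-(δ * sdist bsrc btgt n x t)) := by
    rw [← Real.exp_add]
    refine Real.exp_le_exp.mpr ?_
    have : δ * (sdist bsrc btgt n x t - 1) ≤ δ * sdist bsrc btgt n y t := mul_le_mul_of_nonneg_left (by linarith) hδ0
    linarith
  calc |f (y, j)| ≤ 𝔅 * (n y : ℝ) ^ 2 * Real.exp (-(δ * sdist bsrc btgt n y t)) * m := h1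
    _ ≤ 𝔅 * (Γ * n x) ^ 2 * (Real.exp δ * Real.exp (-(δ * sdist bsrc btgt n x t))) * m := by gcongr
    _ = 𝔅 * Γ ^ 2 * Real.exp δ * (n x : ℝ) ^ 2 * Real.exp (-(δ * sdist bsrc btgt n x t)) * m := by ring

end Ball

/-! ## §3 The averaging part on the `d_n`-ball of radius 1, in SUP currency, via the (P) budget -/

section Averaging

variable [NeZero d] {Cp J K : Type} [Fintype Cp] [DecidableEq Cp] [Fintype J] [Fintype K] [DecidableEq K]
  (S : J → ℕ) (hS : ∀ l, 1 ≤ S l) (hdivS : ∀ l i, S l ∣ N i) (lvl : K → J) (zc : (k : K) → Ctr N (S (lvl k)))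
  (hdisj : ∀ k k' v v', cellPt S hS hdivS lvl zc k v = cellPt S hS hdivS lvl zc k' v' → k = k')
  (hcover : ∀ x : UT N, ∃ k, ∃ v : Box d (S (lvl k)), cellPt S hS hdivS lvl zc k v = x)
  (T : J → UT N → Cp → Cp → ℝ) (hT : ∀ l x i i', ∑ k, T l x k i * T l x k i' = if i = i' then (1 : ℝ) else 0)
  (a : J → ℝ) (ha : ∀ j, 0 ≤ a j) (ω : J → UT N → ℝ)
  (hsupp : ∀ l x, ω l (ctrU N (S l) (tblk (hS l) (hdivS l) x)) ≠ 0 → ∃ k v, lvl k = l ∧ cellPt S hS hdivS lvl zc k v = x)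
  {amax : ℝ} (hamax : 0 ≤ amax)
  (hscale : ∀ k, a (lvl k) * ω (lvl k) (ctrU N (S (lvl k)) (zc k)) ^ 2 * (S (lvl k) : ℝ) ^ d ≤ amax / (S (lvl k) : ℝ) ^ 2)

include hdisj hT ha hsupp hamax hscale

omit [Fintype K] in
/-- **(β₁) THE AVERAGING PART ON THE `d_n`-BALL OF RADIUS 1, SUP CURRENCY.**  If `|f(q)| ≤ 𝔅·n(q)²·e^{−δd_n(q,t)}·m` everywhere,
then for `d_n(y,x) ≤ 1`, `|(Σ_l a_l G_lᵀG_l f)(y,j)| ≤ a_max·√|Cp|·𝔅·e^{δ(4d+1)}·e^{−δd_n(x,t)}·m` — 10a's (P) budget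
`a_max·n(y)⁻²·√(n(y)^{−d}Σ_{cell(y)} f²)`, the cell's `n(y)^d·|Cp|` sites (`card_cellCp_le`) all within `d_n`-distance `4d` of
`y` towards `t` (`cell_in_ball`); the two powers of `n(y)` cancel exactly. [cite: Balaban1985BackgroundPropagators, (3.16) p.393] [folklore] -/
theorem abs_levelSum_le_on_unit_ball {δ 𝔅 m : ℝ} (hδ0 : 0 ≤ δ) (h𝔅0 : 0 ≤ 𝔅) (hm : 0 ≤ m) (f : UT N × Cp → ℝ) (t : UT N)
    (hsup : ∀ q : UT N × Cp, |f q| ≤ 𝔅 * (siteScale S hS hdivS lvl zc hcover q.1 : ℝ) ^ 2 *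
      Real.exp (-(δ * sdist bsrc btgt (siteScale S hS hdivS lvl zc hcover) q.1 t)) * m)
    {x y : UT N} (hy : sdist bsrc btgt (siteScale S hS hdivS lvl zc hcover) y x ≤ 1) (j : Cp) :
    |levelSum (fun l x => ctrU N (S l) (tblk (hS l) (hdivS l) x)) (fun l x => ω l (ctrU N (S l) (tblk (hS l) (hdivS l) x))) T a
        f (y, j)| ≤
      amax * Real.sqrt (Fintype.card Cp) * 𝔅 * Real.exp (δ * (4 * d + 1)) *
        Real.exp (-(δ * sdist bsrc btgt (siteScale S hS hdivS lvl zc hcover) x t)) * m := by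
  classical
  set n := siteScale S hS hdivS lvl zc hcover with hn
  set ky := cellOf S hS hdivS lvl zc hcover y with hky
  set D := sdist bsrc btgt n x t with hD
  set Cl := univ.filter (fun q : UT N × Cp => cellOf S hS hdivS lvl zc hcover q.1 = ky) with hCl
  have hP := abs_levelSum_apply_le S hS hdivS lvl zc hdisj hcover T hT a ha ω hsupp hamax hscale f (y, j) ky rfl
  have hSy : (S (lvl ky) : ℝ) = n y := by rw [hn, siteScale]
  have hny : (0 : ℝ) < n y := by exact_mod_cast one_le_siteScale S hS hdivS lvl zc hcover y
  -- every site of the cell of `y` carries `|f| ≤ Φ`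
  set Φ := 𝔅 * (n y : ℝ) ^ 2 * (Real.exp (δ * (4 * d + 1)) * Real.exp (-(δ * D))) * m with hΦ
  have hΦ0 : 0 ≤ Φ := by rw [hΦ]; positivity
  have htri : D ≤ sdist bsrc btgt n x y + sdist bsrc btgt n y t := sdist_triangle_torus n x y t
  have hsym : sdist bsrc btgt n x y = sdist bsrc btgt n y x := sdist_comm bsrc btgt n x y
  have hcell : ∀ q ∈ Cl, |f q| ≤ Φ := by
    intro q hq
    have hq' : cellOf S hS hdivS lvl zc hcover q.1 = ky := (mem_filter.mp hq).2
    have hnq : (n q.1 : ℝ) = n y := by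
      rw [hn]
      show ((siteScale S hS hdivS lvl zc hcover q.1 : ℕ) : ℝ) = (siteScale S hS hdivS lvl zc hcover y : ℕ)
      rw [siteScale, siteScale, hq']
    -- `d_n(y, t) ≤ d_n(q, t) + 4d` (cellmates)
    have hcm : sdist bsrc btgt n y t ≤ sdist bsrc btgt n q.1 t + 4 * d :=
      cell_in_ball S hS hdivS lvl zc hdisj hcover (x := q.1) (x₀ := t) (q := y) (s := sdist bsrc btgt n q.1 t) le_rfl
        (by rw [hq'])
    have hexp : Real.exp (-(δ * sdist bsrc btgt n q.1 t)) ≤ Real.exp (δ * (4 * d + 1)) * Real.exp (-(δ * D)) := by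
      rw [← Real.exp_add]
      refine Real.exp_le_exp.mpr ?_
      have : δ * (D - 1 - 4 * d) ≤ δ * sdist bsrc btgt n q.1 t := mul_le_mul_of_nonneg_left (by linarith) hδ0
      linarith
    calc |f q| ≤ 𝔅 * (n q.1 : ℝ) ^ 2 * Real.exp (-(δ * sdist bsrc btgt n q.1 t)) * m := hsup q
      _ ≤ 𝔅 * (n q.1 : ℝ) ^ 2 * (Real.exp (δ * (4 * d + 1)) * Real.exp (-(δ * D))) * m := by gcongr
      _ = Φ := by rw [hΦ, hnq]
  -- hence the cell's ℓ² mass is at most `n(y)^d·|Cp|·Φ²`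
  have hcard : ((Cl.card : ℕ) : ℝ) ≤ (S (lvl ky) : ℝ) ^ d * Fintype.card Cp := by
    exact_mod_cast card_cellCp_le S hS hdivS lvl zc hcover ky
  have hmass : ∑ q ∈ Cl, f q ^ 2 ≤ (n y : ℝ) ^ d * Fintype.card Cp * Φ ^ 2 := by
    calc ∑ q ∈ Cl, f q ^ 2 ≤ ∑ q ∈ Cl, Φ ^ 2 := Finset.sum_le_sum fun q hq => by
            have := hcell q hq; rw [← sq_abs]; exact pow_le_pow_left₀ (abs_nonneg _) this 2
      _ = ((Cl.card : ℕ) : ℝ) * Φ ^ 2 := by rw [Finset.sum_const, nsmul_eq_mul]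
      _ ≤ (S (lvl ky) : ℝ) ^ d * Fintype.card Cp * Φ ^ 2 := mul_le_mul_of_nonneg_right hcard (sq_nonneg _)
      _ = (n y : ℝ) ^ d * Fintype.card Cp * Φ ^ 2 := by rw [hSy]
  have hnd : (0 : ℝ) < (n y : ℝ) ^ d := pow_pos hny d
  have hsqrt : Real.sqrt (((n y : ℝ) ^ d)⁻¹ * ∑ q ∈ Cl, f q ^ 2) ≤ Real.sqrt (Fintype.card Cp) * Φ := by
    have h1 : ((n y : ℝ) ^ d)⁻¹ * ∑ q ∈ Cl, f q ^ 2 ≤ Fintype.card Cp * Φ ^ 2 := by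
      calc ((n y : ℝ) ^ d)⁻¹ * ∑ q ∈ Cl, f q ^ 2 ≤ ((n y : ℝ) ^ d)⁻¹ * ((n y : ℝ) ^ d * Fintype.card Cp * Φ ^ 2) :=
            mul_le_mul_of_nonneg_left hmass (by positivity)
        _ = Fintype.card Cp * Φ ^ 2 := by rw [← mul_assoc, ← mul_assoc, inv_mul_cancel₀ hnd.ne', one_mul]
    calc Real.sqrt (((n y : ℝ) ^ d)⁻¹ * ∑ q ∈ Cl, f q ^ 2) ≤ Real.sqrt (Fintype.card Cp * Φ ^ 2) := Real.sqrt_le_sqrt h1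
      _ = Real.sqrt (Fintype.card Cp) * Φ := by rw [Real.sqrt_mul (by positivity), Real.sqrt_sq hΦ0]
  rw [hSy] at hP
  have hn2 : (0 : ℝ) < (n y : ℝ) ^ 2 := pow_pos hny 2
  calc |levelSum (fun l x => ctrU N (S l) (tblk (hS l) (hdivS l) x)) (fun l x => ω l (ctrU N (S l) (tblk (hS l) (hdivS l) x)))
          T a f (y, j)|
        ≤ amax * ((n y : ℝ) ^ 2)⁻¹ * Real.sqrt (((n y : ℝ) ^ d)⁻¹ * ∑ q ∈ Cl, f q ^ 2) := hP
    _ ≤ amax * ((n y : ℝ) ^ 2)⁻¹ * (Real.sqrt (Fintype.card Cp) * Φ) := mul_le_mul_of_nonneg_left hsqrt (by positivity)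
    _ = amax * Real.sqrt (Fintype.card Cp) * 𝔅 * Real.exp (δ * (4 * d + 1)) * Real.exp (-(δ * D)) * m *
          (((n y : ℝ) ^ 2)⁻¹ * (n y : ℝ) ^ 2) := by rw [hΦ]; ring
    _ = amax * Real.sqrt (Fintype.card Cp) * 𝔅 * Real.exp (δ * (4 * d + 1)) * Real.exp (-(δ * D)) * m := by
          rw [inv_mul_cancel₀ hn2.ne', mul_one]

end Averaging

end

end Summit.QuantumFields.BalabanUV.Beta.MultiscaleGradientSource
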